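import Summits.HubbardSuperconductivity.HubbardSuperconductivity.Theorems.TwSourcedCondensation.Negative.SourceResponseStructure

/-!
# Route `ThermalWedge` — support item `TwApproximatingHamiltonian` (stmt-HubbardSuperconductivity-1703),
helper file 1/3: the general-phase gauge rotation of the approximating Hamiltonian

The approximating Hamiltonian of Bogoliubov Jr.'s method for the channel `W = a·Δ_φ`
(`Δ_φ = pairField φ L`) is `T − (c̄ W + c Wᴴ)` with a COMPLEX amplitude `c`, whereas the route's
sourced Hamiltonian `dWaveSourceTorus L U μ h = T − h(Δ_d + Δ_dᴴ)` has a REAL source. The constant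
`U(1)` gauge rotation `W_{g₀} = phaseGauge (fun _ => g₀)` (tree: `phaseGauge`, Koma–Tasaki 1992
eqs. (5)–(8)) fixes `T = hubbardTorusWith 2 L t U μ` and multiplies every pair annihilator by
`conj(g₀)²`; choosing `g₀ = e^{-i arg(c)/2}` turns `c̄ W + c Wᴴ` into `|c| (W + Wᴴ)`, so the two
partition functions agree (`partitionFn_unitary_conj`). This removes the phase of `c` in the hard
half of `TwApproximatingHamiltonian`.
-/

namespace Summit.HubbardSuperconductivity.HubbardSuperconductivity.Theorems

open Literature.MathematicalPhysics.QuantumLattice Matrix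
open Literature.Probability.LatticeModels
open Summit.HubbardSuperconductivity.HubbardSuperconductivity.Theorems.TwSourcedCondensation.Negative
open scoped ComplexConjugate ComplexOrder

section Gauge

variable {Λ : Type*} [LinearOrder Λ] [Fintype Λ]

/-- A constant gauge rotation multiplies every pair annihilator `c_{xσ} c_{yτ}` by `conj(g₀)²`.
[cite: KomaTasakiPRL1992, eq. (8)] [folklore] -/
theorem twAhm_phaseGauge_const_conj_annihilation_mul_annihilation (g₀ : Circle) (x y : Λ)
    (σ τ : Fin 2) :
    phaseGauge (fun _ : Λ => g₀) * (annihilation (orb x σ) * annihilation (orb y τ)) *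
        (phaseGauge (fun _ : Λ => g₀))ᴴ =
      (conj (g₀ : ℂ) * conj (g₀ : ℂ)) • (annihilation (orb x σ) * annihilation (orb y τ)) := by
  rw [phaseGauge_mul_mul_mul_conjTranspose, phaseGauge_mul_annihilation_mul_conjTranspose,
    phaseGauge_mul_annihilation_mul_conjTranspose, smul_mul_smul_comm]

end Gauge

section Torus

variable (L : ℕ) [NeZero L]

/-- `W_{g₀} P_x W_{g₀}ᴴ = conj(g₀)² P_x` for every local pair of any form factor.
[cite: KomaTasakiPRL1992, eq. (8)] [folklore] -/
theorem twAhm_phaseGauge_const_conj_localPair (g₀ : Circle) (φ : Site 2 → ℝ) (x : TorusSite 2 L) :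
    phaseGauge (fun _ : FermionTorus 2 L => g₀) * localPair φ L x *
        (phaseGauge (fun _ : FermionTorus 2 L => g₀))ᴴ =
      (conj (g₀ : ℂ) * conj (g₀ : ℂ)) • localPair φ L x := by
  unfold localPair
  simp only [Finset.mul_sum, Finset.sum_mul, Matrix.mul_smul, Matrix.smul_mul, Matrix.mul_sub,
    Matrix.sub_mul, twAhm_phaseGauge_const_conj_annihilation_mul_annihilation, Finset.smul_sum,
    smul_sub, smul_smul]
  refine Finset.sum_congr rfl fun e _ => ?_
  rw [mul_comm]

/-- `W_{g₀} Δ_φ W_{g₀}ᴴ = conj(g₀)² Δ_φ` for the pair field of any form factor.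
[cite: KomaTasakiPRL1992, eq. (8)] [folklore] -/
theorem twAhm_phaseGauge_const_conj_pairField (g₀ : Circle) (φ : Site 2 → ℝ) :
    phaseGauge (fun _ : FermionTorus 2 L => g₀) * pairField φ L *
        (phaseGauge (fun _ : FermionTorus 2 L => g₀))ᴴ =
      (conj (g₀ : ℂ) * conj (g₀ : ℂ)) • pairField φ L := by
  unfold pairField
  simp only [Finset.mul_sum, Finset.sum_mul, twAhm_phaseGauge_const_conj_localPair, Finset.smul_sum]

/-- `W_{g₀} Δ_φᴴ W_{g₀}ᴴ = g₀² Δ_φᴴ`. [cite: KomaTasakiPRL1992, eq. (8)] [folklore] -/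
theorem twAhm_phaseGauge_const_conj_pairField_conjTranspose (g₀ : Circle) (φ : Site 2 → ℝ) :
    phaseGauge (fun _ : FermionTorus 2 L => g₀) * (pairField φ L)ᴴ *
        (phaseGauge (fun _ : FermionTorus 2 L => g₀))ᴴ =
      ((g₀ : ℂ) * (g₀ : ℂ)) • (pairField φ L)ᴴ := by
  rw [phaseGauge_mul_conjTranspose_mul_conjTranspose, twAhm_phaseGauge_const_conj_pairField,
    conjTranspose_smul, star_mul', Complex.star_def, Complex.conj_conj]

omit [NeZero L] in
/-- `W_{g₀} K₀ W_{g₀}ᴴ = K₀` for the grand-canonical torus Hubbard Hamiltonian and any constant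
phase. [cite: KomaTasakiPRL1992, eq. (7)] [folklore] -/
theorem twAhm_phaseGauge_const_conj_hubbardTorusWith (g₀ : Circle) (t U μ : ℝ) :
    phaseGauge (fun _ : FermionTorus 2 L => g₀) * hubbardTorusWith 2 L t U μ *
        (phaseGauge (fun _ : FermionTorus 2 L => g₀))ᴴ = hubbardTorusWith 2 L t U μ := by
  unfold hubbardTorusWith; exact phaseGauge_const_conj_hamiltonianWith _ _ t U μ

omit [NeZero L] in
/-- `W_{g₀}ᴴ W_{g₀} = 1` on the torus (the `DecidableEq` instance found on `FermionTorus` differs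
syntactically from the `LinearOrder`-derived one inside `phaseGauge`; `convert` bridges it). [folklore] -/
theorem twAhm_conjTranspose_phaseGauge_mul_self (g₀ : Circle) :
    (phaseGauge (fun _ : FermionTorus 2 L => g₀))ᴴ * phaseGauge (fun _ : FermionTorus 2 L => g₀) = 1 := by
  have h := conjTranspose_phaseGauge_mul_self (Λ := FermionTorus 2 L) fun _ => g₀
  convert h

omit [NeZero L] in
/-- `W_{g₀} W_{g₀}ᴴ = 1` on the torus. [folklore] -/
theorem twAhm_phaseGauge_mul_conjTranspose_self (g₀ : Circle) :
    phaseGauge (fun _ : FermionTorus 2 L => g₀) * (phaseGauge (fun _ : FermionTorus 2 L => g₀))ᴴ = 1 := by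
  have h := phaseGauge_mul_conjTranspose_self (Λ := FermionTorus 2 L) fun _ => g₀
  convert h

omit [NeZero L] in
/-- `W_{g₀}` is unitary on the torus Fock space. [folklore] -/
theorem twAhm_phaseGauge_const_mem_unitary (g₀ : Circle) :
    phaseGauge (fun _ : FermionTorus 2 L => g₀) ∈
      unitary (Matrix (Finset (Orb (FermionTorus 2 L))) (Finset (Orb (FermionTorus 2 L))) ℂ) := by
  rw [Unitary.mem_iff, star_eq_conjTranspose]
  exact ⟨twAhm_conjTranspose_phaseGauge_mul_self L g₀, twAhm_phaseGauge_mul_conjTranspose_self L g₀⟩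

/-- The half-angle phase `g₀ = e^{-i arg(c)/2}` satisfies `c · g₀² = |c|`. [folklore] -/
theorem twAhm_mul_halfPhase_sq (c : ℂ) :
    c * (((Circle.exp (-(Complex.arg c) / 2) : Circle) : ℂ) *
      ((Circle.exp (-(Complex.arg c) / 2) : Circle) : ℂ)) = (‖c‖ : ℂ) := by
  rw [← Circle.coe_mul, ← Circle.exp_add, add_halves, Circle.coe_exp]
  have h := Complex.norm_mul_exp_arg_mul_I c
  calc c * Complex.exp (((-Complex.arg c : ℝ) : ℂ) * Complex.I)
      = (‖c‖ : ℂ) * (Complex.exp ((Complex.arg c : ℂ) * Complex.I) *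
          Complex.exp (((-Complex.arg c : ℝ) : ℂ) * Complex.I)) := by
        rw [← mul_assoc, h]
    _ = (‖c‖ : ℂ) := by
        rw [← Complex.exp_add, Complex.ofReal_neg, neg_mul, add_neg_cancel, Complex.exp_zero,
          mul_one]

/-- … and `conj c · conj(g₀)² = |c|`. [folklore] -/
theorem twAhm_conj_mul_conj_halfPhase_sq (c : ℂ) :
    conj c * (conj ((Circle.exp (-(Complex.arg c) / 2) : Circle) : ℂ) *
      conj ((Circle.exp (-(Complex.arg c) / 2) : Circle) : ℂ)) = (‖c‖ : ℂ) := by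
  rw [← map_mul, ← map_mul, twAhm_mul_halfPhase_sq, Complex.conj_ofReal]

/-- **The gauge rotation removes the phase of the approximating amplitude**: conjugating
`T − (c̄ W + c Wᴴ)`, `W = a·Δ_φ`, by `W_{g₀}` with `g₀ = e^{-i arg(c)/2}` gives
`T − |c|a (Δ_φ + Δ_φᴴ)`. [cite: KomaTasakiPRL1992, eqs. (7)–(8)] [folklore] -/
theorem twAhm_phaseGauge_conj_approx (t U μ a : ℝ) (φ : Site 2 → ℝ) (c : ℂ) :
    phaseGauge (fun _ : FermionTorus 2 L => Circle.exp (-(Complex.arg c) / 2)) *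
        (hubbardTorusWith 2 L t U μ -
          (starRingEnd ℂ c • ((a : ℂ) • pairField φ L) + c • ((a : ℂ) • pairField φ L)ᴴ)) *
        (phaseGauge (fun _ : FermionTorus 2 L => Circle.exp (-(Complex.arg c) / 2)))ᴴ =
      hubbardTorusWith 2 L t U μ -
        ((‖c‖ * a : ℝ) : ℂ) • (pairField φ L + (pairField φ L)ᴴ) := by
  have hΔ := twAhm_phaseGauge_const_conj_pairField L (Circle.exp (-(Complex.arg c) / 2)) φ
  have hΔ' := twAhm_phaseGauge_const_conj_pairField_conjTranspose L
    (Circle.exp (-(Complex.arg c) / 2)) φ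
  have hT := twAhm_phaseGauge_const_conj_hubbardTorusWith L (Circle.exp (-(Complex.arg c) / 2)) t U μ
  have hreal : ((a : ℂ) • pairField φ L)ᴴ = (a : ℂ) • (pairField φ L)ᴴ := by
    rw [conjTranspose_smul, Complex.star_def, Complex.conj_ofReal]
  have h1 : starRingEnd ℂ c * (a : ℂ) * (conj ((Circle.exp (-(Complex.arg c) / 2) : Circle) : ℂ) *
      conj ((Circle.exp (-(Complex.arg c) / 2) : Circle) : ℂ)) = ((‖c‖ * a : ℝ) : ℂ) := by
    calc starRingEnd ℂ c * (a : ℂ) * (conj ((Circle.exp (-(Complex.arg c) / 2) : Circle) : ℂ) *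
          conj ((Circle.exp (-(Complex.arg c) / 2) : Circle) : ℂ))
        = (a : ℂ) * (conj c * (conj ((Circle.exp (-(Complex.arg c) / 2) : Circle) : ℂ) *
            conj ((Circle.exp (-(Complex.arg c) / 2) : Circle) : ℂ))) := by ring
      _ = ((‖c‖ * a : ℝ) : ℂ) := by rw [twAhm_conj_mul_conj_halfPhase_sq]; push_cast; ring
  have h2 : c * (a : ℂ) * (((Circle.exp (-(Complex.arg c) / 2) : Circle) : ℂ) *
      ((Circle.exp (-(Complex.arg c) / 2) : Circle) : ℂ)) = ((‖c‖ * a : ℝ) : ℂ) := by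
    calc c * (a : ℂ) * (((Circle.exp (-(Complex.arg c) / 2) : Circle) : ℂ) *
          ((Circle.exp (-(Complex.arg c) / 2) : Circle) : ℂ))
        = (a : ℂ) * (c * (((Circle.exp (-(Complex.arg c) / 2) : Circle) : ℂ) *
            ((Circle.exp (-(Complex.arg c) / 2) : Circle) : ℂ))) := by ring
      _ = ((‖c‖ * a : ℝ) : ℂ) := by rw [twAhm_mul_halfPhase_sq]; push_cast; ring
  rw [hreal, Matrix.mul_sub, Matrix.sub_mul, hT, Matrix.mul_add, Matrix.add_mul, Matrix.mul_smul,
    Matrix.smul_mul, Matrix.mul_smul, Matrix.smul_mul, Matrix.mul_smul, Matrix.smul_mul,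
    Matrix.mul_smul, Matrix.smul_mul, hΔ, hΔ', smul_smul, smul_smul, smul_smul, smul_smul, h1, h2,
    smul_add]

/-- **Gauge invariance of the approximating partition function**:
`Z_β(T − (c̄ W + c Wᴴ)) = Z_β(T − |c|a(Δ_φ + Δ_φᴴ))` for `W = a·Δ_φ`.
[cite: KomaTasakiPRL1992, eqs. (5)–(8)] [folklore] -/
theorem twAhm_partitionFn_approx_eq (β t U μ a : ℝ) (φ : Site 2 → ℝ) (c : ℂ) :
    partitionFn β (hubbardTorusWith 2 L t U μ -
        (starRingEnd ℂ c • ((a : ℂ) • pairField φ L) + c • ((a : ℂ) • pairField φ L)ᴴ)) =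
      partitionFn β (hubbardTorusWith 2 L t U μ -
        ((‖c‖ * a : ℝ) : ℂ) • (pairField φ L + (pairField φ L)ᴴ)) := by
  have hu := partitionFn_unitary_conj
    (twAhm_phaseGauge_const_mem_unitary L (Circle.exp (-(Complex.arg c) / 2))) β
    (hubbardTorusWith 2 L t U μ -
      (starRingEnd ℂ c • ((a : ℂ) • pairField φ L) + c • ((a : ℂ) • pairField φ L)ᴴ))
  rw [star_eq_conjTranspose, twAhm_phaseGauge_conj_approx] at hu
  exact hu.symm

/-- Specialisation to the route's objects: for `W = √g·Δ_d` (`g ≥ 0` not even needed here) and any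
complex amplitude `c`, `Z_β(T − (c̄ W + c Wᴴ)) = Z_β(dWaveSourceTorus L U μ (|c|·a))`. [folklore] -/
theorem twAhm_partitionFn_approx_eq_dWaveSourceTorus (β U μ a : ℝ) (c : ℂ) :
    partitionFn β (hubbardTorusWith 2 L 1 U μ -
        (starRingEnd ℂ c • ((a : ℂ) • pairField dWaveFormFactor L) +
          c • ((a : ℂ) • pairField dWaveFormFactor L)ᴴ)) =
      partitionFn β (dWaveSourceTorus L U μ (‖c‖ * a)) := by
  rw [twAhm_partitionFn_approx_eq, dWaveSourceTorus]

end Torus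

end Summit.HubbardSuperconductivity.HubbardSuperconductivity.Theorems
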